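import Literature.AnabelianGeometry.EtaleTheta.MuTwoSettingPiCData
import Literature.AnabelianGeometry.EtaleTheta.SettingModelMuTwoInversion
import Literature.AnabelianGeometry.EtaleTheta.Discharge.Sec2Prop22InvThetaOfInvEll
import HarnessLib

/-!
# [EtTh] §2 over §1: the binder «`ι` acts on `Δ̄^ell_X` by `−1`» (`hιell`, GAP-LEDGER G-L2t10-4 (a))
# REDUCED to the C-level clause «`ι̂ ≡ −1` on `Δ_X^ab`» and WITNESSED at the inversion model

S. Mochizuki, *The étale theta function and its Frobenioid-theoretic manifestations*, Publ. RIMS **45**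
(2009) [EtTh], §2 p. 36 (printed 262): «`ι` for the automorphism of order two [of `X^log`] … i.e.,
“multiplication by `−1`” on the underlying elliptic curve … `C^log` … the stack-theoretic quotient of
`X^log` by the action of `ι`»; Rmk. 2.1.1 p. 36 «`ι` acts on `Q` by multiplication by `−1`»; Prop. 2.2 (i)
p. 37 (printed 263): «the action of `Π_C` on `Δ̄_X` by conjugation induces … eigenvalues `−1` and `1` [on
`Δ̄^ell_X`, `Δ̄_Θ`] respectively» [cite: MochizukiEtTh2009, Prop 2.2 (i) p.37].

Cell abc-iut, layer L2, seat abc-iut-L2-t10 (gen 5; lineage of `ThetaCoversModelPiC` / `ThetaCoversAxOfSetting`).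
The constructor `ThetaSetting.PiCData.coverDataAx` (the genuine `ThetaCovers.CoverDataAx l` over the
arithmetic setting) takes the printed input P-C4 as the BINDER
`hιell : ∀ c ∈ Ker(Π_C ↠ G_K), c ∉ Π_X → ∀ d ∈ Π_X ∩ Δ_C, c·d·c⁻¹·d ∈ barTheta l` («`ι` acts by `−1` on
`Δ̄^ell_X`»), GAP-LEDGER G-L2t10-4 (a): a property of the INPUT `Π_C ⊋ Π_X`, underivable from the bundle
`PiCData` alone (the product datum `Π_X × ℤ/2` violates it). PROOF-ONLY file (0 definitions):

* §1 (generic, `I : D.PiCData PiC`): `PiCData.inv_ell_of_one` — the binder for ALL `c` follows from ONE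
  geometric `c₁ ∉ Π_X` (index `2`: `c = c₁·x` with `x ∈ Δ_X`; `⁅Δ_X,Δ_X⁆ ≤ barTheta ⊴ Π_C`);
* §2 (abc-iut-L2-d3's `CLevelData.piCDataOf e ιC hιC` — `Π_C` a profinite completion of `Π^tp_C`): the
  BRIDGE `piCDataOf_conj_incl` «`ιC g · incl y · (ιC g)⁻¹ = incl (ĝ y)`» with `ĝ := completionAut (e.conjX g)`
  (density of `Π^tp_X` in `Π_X`), whence `Δ_X ⊴ Π_C` and `barTheta ⊴ Π_C` for the CONSTRUCTED datum WITHOUT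
  the once-punctured clause (P1), and the pointwise law `piCDataOf_conj_mul_mem_barTheta_of_hinv`:
  «`ιC g · d · (ιC g)⁻¹ · d ∈ barTheta l` for `d ∈ Δ_X`» from abc-iut-w5-d072's C-level clause (R1e′)
  `∀ y ∈ Δ_X, ĝ y · y ∈ ⁅Δ_X,Δ_X⁆⁻` for THAT `g`;
* §3 **`CLevelData.piCDataOf_inv_ell_of_hinv` / `piCData_inv_ell_of_hinv`**: the binder `hιell` of
  `PiCData.coverDataAx` at `e.piCDataOf ιC hιC` / `e.piCData` from (R1e′) for ONE `g ∈ Π^tp_C` with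
  `augC g = 1`, `g ∉ inclX(Π^tp_X)` (such `g` exist: `CLevelData.exists_geometric_not_mem_range`), given (P1)
  `Ker(Π_X → G_K) = Δ_X` (`OncePuncturedData`); `piCData_inv_theta_of_hinv` = abc-iut-L6-d6's
  `inv_theta_of_inv_ell` after it — G-L2t10-4 (a) REDUCED to the origin clause (R1e′) on the `Π^tp_C` datum;
* §4 **WITNESSED at abc-iut-w5-d072's inversion model** `MuTwoSetting.inversionModel p` (`Π^tp_C =
  Π^tp_X ⋊_ι ℤ/2`, `SettingModelMuTwoInversion.lean`), for EVERY C-level datum `e` over it: `ε̂_± ∉ Π_X`,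
  some `c ∈ Ker(Π_C ↠ G_K) ∖ Π_X` exists, and
  `inversionModel_piCData_inv_ell_deltaX : ∀ c ∈ Π_C ∖ Π_X, ∀ d ∈ Δ_X, c·d·c⁻¹·d ∈ barTheta l` — the
  `Δ_X`-form of the binder HOLDS there (via `e.conjX ε_± = SettingModel.inversion p`, w5-d072's (R1e′)
  `inversion_hinv`, and the root's trivial `Π_X`-action on `Δ_X^ab`). HONEST LIMIT: the consumer form
  quantifies over `Π_X ∩ Δ_C`, which equals `Δ_X` under (P1); at the ROOT model `OncePuncturedData` is EMPTY
  (`SettingModelOncePuncturedEmpty`) and (P1) itself would need the injectivity of `Γ̂ → G_{ℚ_p}` (the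
  abstract profinite completion of `G_{ℚ_p}`), which is not claimed — so §4 delivers the `Δ_X`-form;
  C-level data over the inversion model exist (`MuTwoSetting.inversionModel_cLevelData`,
  `SettingModelMuTwoInversionCLevel.lean`, not imported here); consistency evidence only.

Nothing of [EtTh] is asserted beyond what is proved; no new `Prop` fact; zero edit of any other seat's
file; no side is taken on [IUTchIII] Cor. 3.12; typed ≠ proved; a model is consistency evidence only.
-/

noncomputable section

namespace Literature.AnabelianGeometry.EtaleTheta

open scoped commutatorElement
open _root_.Topology Literature.AnabelianGeometry.SemiGraphs

/-! ## §1. Generic: the binder for all `c` from one geometric `c₁ ∉ Π_X` -/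

namespace ThetaSetting.PiCData

variable {p : ℕ} [Fact p.Prime] {D : ThetaSetting p} {PiC : Type} [Group PiC] [TopologicalSpace PiC]
  [IsTopologicalGroup PiC] [T2Space PiC] (I : D.PiCData PiC) (l : ℕ)

/-- `⁅Δ_X, Δ_X⁆ ≤ Δ̄_Θ`-preimage inside `Π_C` («`[Δ̄_X, Δ̄_X] = Δ̄_Θ`», p. 35). [cite: MochizukiEtTh2009, Def 2.1 p.35] -/
theorem commutator_deltaX_le_barTheta : ⁅I.DeltaX, I.DeltaX⁆ ≤ I.barTheta l :=
  le_sup_left.trans (Subgroup.le_topologicalClosure _)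

/-- `⁅Δ_X, Δ_X⁆⁻ ≤ Δ̄_Θ`-preimage inside `Π_C` (the preimage is closed). [cite: MochizukiEtTh2009, Def 2.1 p.35] -/
theorem closure_commutator_deltaX_le_barTheta : (⁅I.DeltaX, I.DeltaX⁆).topologicalClosure ≤ I.barTheta l :=
  Subgroup.topologicalClosure_minimal _ (I.commutator_deltaX_le_barTheta l) (ClassTwoBar.isClosed_barThetaOf _ l)

/-- The image of `⁅Δ_X, Δ_X⁆⁻ ⊆ Π_X` under `Π_X ↪ Π_C` lies in the `Δ̄_Θ`-preimage (closed embedding: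
closures and commutators are carried along). [cite: MochizukiEtTh2009, Def 2.1 p.35] -/
theorem map_closure_commutator_le_barTheta :
    ((⁅D.DeltaHat, D.DeltaHat⁆).topologicalClosure).map I.incl.toMonoidHom ≤ I.barTheta l := by
  rw [ClassTwoBar.map_topologicalClosure_of_isClosedEmbedding I.incl I.isClosedEmbedding_incl,
    Subgroup.map_commutator]
  exact I.closure_commutator_deltaX_le_barTheta l

/-- Group-theoretic bookkeeping: if `x` commutes with `d` modulo a normal subgroup `N` and `c₁·d·c₁⁻¹·d ∈ N`,
then `(c₁x)·d·(c₁x)⁻¹·d ∈ N` (`(c₁x) d (c₁x)⁻¹ d = (c₁ ⁅x,d⁆ c₁⁻¹) · (c₁ d c₁⁻¹ d)`).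
[cite: MochizukiEtTh2009, Prop 2.2 (i) p.37] -/
theorem conj_mul_mem_of_commutator_mem {G : Type*} [Group G] (N : Subgroup G) (hN : N.Normal)
    {c₁ x d : G} (hk : x * d * x⁻¹ * d⁻¹ ∈ N) (h₁ : c₁ * d * c₁⁻¹ * d ∈ N) :
    c₁ * x * d * (c₁ * x)⁻¹ * d ∈ N := by
  have key : c₁ * x * d * (c₁ * x)⁻¹ * d = (c₁ * (x * d * x⁻¹ * d⁻¹) * c₁⁻¹) * (c₁ * d * c₁⁻¹ * d) := by
    group
  rw [key]
  exact N.mul_mem (hN.conj_mem _ hk c₁) h₁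

/-- **The binder `hιell` for ALL `c ∈ Δ_C ∖ Π_X` from ONE `c₁`** («`ι` acts on `Δ̄^ell_X` by `−1`»: `Δ_C ∖ Δ_X
= c₁·Δ_X` since `[Π_C : Π_X] = 2`, and `Δ_X` acts trivially on `Δ̄^ell_X = Δ̄_X/Δ̄_Θ`), given (P1) through
the once-punctured parameters. [cite: MochizukiEtTh2009, Prop 2.2 (i) p.37] -/
theorem inv_ell_of_one (e : D.OncePuncturedData) {c₁ : PiC} (hc₁ : c₁ ∈ I.augGK.ker) (hc₁X : c₁ ∉ I.PiX)
    (h₁ : ∀ d ∈ I.PiX ⊓ I.augGK.ker, c₁ * d * c₁⁻¹ * d ∈ I.barTheta l) :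
    ∀ c ∈ I.augGK.ker, c ∉ I.PiX → ∀ d ∈ I.PiX ⊓ I.augGK.ker, c * d * c⁻¹ * d ∈ I.barTheta l := by
  intro c hc hcX d hd
  -- `x := c₁⁻¹ c ∈ Π_X ∩ Δ_C = Δ_X`
  have hxX : c₁⁻¹ * c ∈ I.PiX :=
    (Subgroup.mul_mem_iff_of_index_two I.index_range).2
      (iff_of_false (fun h => hc₁X (by simpa using h)) hcX)
  have hx : c₁⁻¹ * c ∈ I.PiX ⊓ I.augGK.ker := ⟨hxX, I.augGK.ker.mul_mem (I.augGK.ker.inv_mem hc₁) hc⟩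
  have hk : c₁⁻¹ * c * d * (c₁⁻¹ * c)⁻¹ * d⁻¹ ∈ I.barTheta l := by
    rw [← I.deltaX_eq e] at hx hd
    exact I.commutator_deltaX_le_barTheta l (Subgroup.commutator_mem_commutator hx hd)
  have h := conj_mul_mem_of_commutator_mem (I.barTheta l) (I.barTheta_normal l e) hk (h₁ d hd)
  rwa [mul_inv_cancel_left] at h

end ThetaSetting.PiCData

/-! ## §2. At the constructed datum `piCDataOf`: the bridge to `Π^tp_C`-conjugation -/

namespace MuTwoSetting.CLevelData

variable {p : ℕ} [Fact p.Prime] {M : MuTwoSetting p}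
variable {PC : Type} [Group PC] [TopologicalSpace PC] [IsTopologicalGroup PC] [T2Space PC]
variable (e : M.CLevelData) (ιC : M.GtpC →ₜ* PC) (hιC : IsProfiniteCompletion ιC)

/-- **BRIDGE**: conjugation by `ιC g` on `Π_X ⊆ Π_C` is the completed restricted inner automorphism:
`ιC g · incl y · (ιC g)⁻¹ = incl (ĝ y)` with `ĝ := completionAut (e.conjX g)` (both sides are continuous in
`y` and agree on the dense `Π^tp_X`, where `inclX (g x g⁻¹|_X) = g · inclX x · g⁻¹`).
[cite: MochizukiEtTh2009, Def 2.1 p.36] -/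
theorem piCDataOf_conj_incl (g : M.GtpC) (y : M.PiHat) :
    ιC g * (e.piCDataOf ιC hιC).incl y * (ιC g)⁻¹ =
      (e.piCDataOf ιC hιC).incl (M.completionAut (e.conjX g) y) := by
  set I := e.piCDataOf ιC hιC with hI
  have h1 : Continuous fun y : M.PiHat => ιC g * I.incl y * (ιC g)⁻¹ :=
    (continuous_const.mul I.incl.continuous).mul continuous_const
  have h2 : Continuous fun y : M.PiHat => I.incl (M.completionAut (e.conjX g) y) :=
    I.incl.continuous.comp (M.completionAut (e.conjX g)).continuous
  have heq := Continuous.ext_on M.isProfiniteCompletion_toHat.denseRange h1 h2 (by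
    rintro _ ⟨x, rfl⟩
    change ιC g * I.incl (M.toHat x) * (ιC g)⁻¹ = I.incl (M.completionAut (e.conjX g) (M.toHat x))
    rw [TemperedCurve.completionAut_toHat, hI, e.piCDataOf_incl_toHat ιC hιC, e.piCDataOf_incl_toHat ιC hιC,
      e.inclX_conjX, map_mul, map_mul, map_inv])
  exact congrFun heq y

/-- A restricted inner automorphism of `Π^tp_C` carries `Δ_X ⊆ Π_X` into itself after completion
(`e.map_deltaTemp_conjX` + `TemperedCurve.map_deltaHat_completionAut`). [cite: MochizukiEtTh2009, Def 2.1 p.36] -/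
theorem completionAut_conjX_mem_deltaHat (g : M.GtpC) {y : M.PiHat} (hy : y ∈ M.DeltaHat) :
    M.completionAut (e.conjX g) y ∈ M.DeltaHat := by
  have h : (M.completionAut (e.conjX g)).toMulEquiv.toMonoidHom y ∈
      M.DeltaHat.map (M.completionAut (e.conjX g)).toMulEquiv.toMonoidHom := ⟨y, hy, rfl⟩
  rwa [TemperedCurve.map_deltaHat_completionAut _ _ (e.map_deltaTemp_conjX g)] at h

/-- `ιC g ∈ Π_X ⊆ Π_C` iff `g ∈ inclX(Π^tp_X)`: the open subgroup `Π_X = incl(Π_X)` of the completion pulls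
back to `Π^tp_X` (`exists_openNormal_range_hatInclX_eq`). [cite: MochizukiEtTh2009, Def 2.1 p.36] -/
theorem piCDataOf_ιC_mem_PiX_iff (g : M.GtpC) : ιC g ∈ (e.piCDataOf ιC hιC).PiX ↔ g ∈ M.inclX.range := by
  obtain ⟨V, hV, hrange⟩ :=
    exists_openNormal_range_hatInclX_eq (M := M) ιC hιC (e.piCDataOf ιC hιC).incl (e.piCDataOf_incl_toHat ιC hιC)
  rw [hV, Subgroup.mem_comap]
  change ιC g ∈ (e.piCDataOf ιC hιC).incl.toMonoidHom.range ↔ ιC g ∈ V.toSubgroup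
  rw [← SetLike.mem_coe, MonoidHom.coe_range, ← SetLike.mem_coe]
  exact hrange ▸ Iff.rfl

/-- `ιC g ∈ Ker(Π_C ↠ G_K)` iff `augC g = 1` (`aug ∘ ιC = augC`). [cite: MochizukiEtTh2009, Def 2.1 p.36] -/
theorem piCDataOf_ιC_mem_ker_augGK_iff (g : M.GtpC) :
    ιC g ∈ (e.piCDataOf ιC hιC).augGK.ker ↔ e.augC g = 1 := by
  rw [(e.piCDataOf ιC hιC).mem_ker_augGK, e.piCDataOf_aug_apply]

/-- **`Δ_X ⊴ Π_C` for the constructed datum, WITHOUT (P1)**: `Π_X` normalises `Δ_X` (`Δ_X ⊴ Π_X`), and so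
does `ιC g` for every `g ∈ Π^tp_C` (bridge + `completionAut_conjX_mem_deltaHat`); with `[Π_C : Π_X] = 2`
and one `g ∉ inclX(Π^tp_X)` (`ε_±`) these exhaust `Π_C`. [cite: MochizukiEtTh2009, Def 2.1 p.36] -/
theorem piCDataOf_deltaX_normal : (e.piCDataOf ιC hιC).DeltaX.Normal := by
  set I := e.piCDataOf ιC hιC with hI
  -- conjugation by elements of `Π_X`
  have hX : ∀ x ∈ I.PiX, ∀ d ∈ I.DeltaX, x * d * x⁻¹ ∈ I.DeltaX := by
    rintro _ ⟨y, rfl⟩ _ ⟨d, hd, rfl⟩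
    refine ⟨y * d * y⁻¹, M.deltaHat_normal'.conj_mem d hd y, ?_⟩
    simp only [map_mul, map_inv, ContinuousMonoidHom.coe_toMonoidHom]
  -- conjugation by `ιC g`
  have hC : ∀ g : M.GtpC, ∀ d ∈ I.DeltaX, ιC g * d * (ιC g)⁻¹ ∈ I.DeltaX := by
    rintro g _ ⟨d, hd, rfl⟩
    refine ⟨M.completionAut (e.conjX g) d, e.completionAut_conjX_mem_deltaHat g hd, ?_⟩
    change I.incl _ = ιC g * I.incl d * (ιC g)⁻¹
    rw [hI, e.piCDataOf_conj_incl ιC hιC]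
  refine ⟨fun d hd c => ?_⟩
  by_cases hc : c ∈ I.PiX
  · exact hX c hc d hd
  · -- `c = ιC ε_± · x` with `x ∈ Π_X`
    have hε : ιC M.epsPM ∉ I.PiX := by
      rw [hI, e.piCDataOf_ιC_mem_PiX_iff ιC hιC]
      exact M.epsPM_not_mem
    have hxX : (ιC M.epsPM)⁻¹ * c ∈ I.PiX :=
      (Subgroup.mul_mem_iff_of_index_two I.index_range).2
        (iff_of_false (fun h => hε (by simpa using h)) hc)
    have h := hC M.epsPM _ (hX _ hxX d hd)
    have key : ιC M.epsPM * ((ιC M.epsPM)⁻¹ * c * d * ((ιC M.epsPM)⁻¹ * c)⁻¹) * (ιC M.epsPM)⁻¹ =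
        c * d * c⁻¹ := by group
    rwa [key] at h

/-- Hence the `Δ̄_Θ`-preimage is normal in `Π_C` for the constructed datum, without (P1).
[cite: MochizukiEtTh2009, Def 2.1 p.35] -/
theorem piCDataOf_barTheta_normal (l : ℕ) : ((e.piCDataOf ιC hιC).barTheta l).Normal :=
  ClassTwoBar.barThetaOf_normal _ l (e.piCDataOf_deltaX_normal ιC hιC)

/-- Hence `Ker(Δ_X ↠ Δ̄_X)` is normal in `Π_C` for the constructed datum, without (P1).
[cite: MochizukiEtTh2009, Def 2.1 p.35] -/
theorem piCDataOf_barKer_normal (l : ℕ) : ((e.piCDataOf ιC hιC).barKer l).Normal :=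
  ClassTwoBar.barKerOf_normal _ l (e.piCDataOf_deltaX_normal ιC hιC)

/-- **Pointwise law**: if the completed restricted inner automorphism `ĝ` of `g ∈ Π^tp_C` satisfies the
C-level clause (R1e′) «`ĝ ≡ −1` on `Δ_X^ab`» (`∀ y ∈ Δ_X, ĝ y · y ∈ ⁅Δ_X,Δ_X⁆⁻`, abc-iut-w5-d072's `hinv`),
then `ιC g · d · (ιC g)⁻¹ · d ∈ barTheta l` for every `d ∈ Δ_X ⊆ Π_C` — the content of «`ι` acts on
`Δ̄^ell_X` by `−1`» for the element `ιC g`. [cite: MochizukiEtTh2009, Prop 2.2 (i) p.37] -/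
theorem piCDataOf_conj_mul_mem_barTheta_of_hinv (l : ℕ) {g : M.GtpC}
    (hinv : ∀ y ∈ M.DeltaHat,
      M.completionAut (e.conjX g) y * y ∈ (⁅M.DeltaHat, M.DeltaHat⁆).topologicalClosure) :
    ∀ d ∈ (e.piCDataOf ιC hιC).DeltaX, ιC g * d * (ιC g)⁻¹ * d ∈ (e.piCDataOf ιC hιC).barTheta l := by
  rintro _ ⟨y, hy, rfl⟩
  change ιC g * (e.piCDataOf ιC hιC).incl y * (ιC g)⁻¹ * (e.piCDataOf ιC hιC).incl y ∈ _
  rw [e.piCDataOf_conj_incl ιC hιC, ← map_mul]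
  exact (e.piCDataOf ιC hιC).map_closure_commutator_le_barTheta l ⟨_, hinv y hy, rfl⟩

/-! ## §3. The binder `hιell` of `PiCData.coverDataAx` from the C-level clause (R1e′) -/

/-- **G-L2t10-4 (a) REDUCED to (R1e′) at the constructed datum**: over `e.piCDataOf ιC hιC`, the binder
`hιell` of `ThetaSetting.PiCData.coverDataAx` («`ι` acts on `Δ̄^ell_X` by `−1`», for ALL `c ∈ Δ_C ∖ Π_X`
and `d ∈ Π_X ∩ Δ_C`) follows from the C-level clause (R1e′) for ONE `g ∈ Π^tp_C` over `1 ∈ G_K` outside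
`Π^tp_X` (such `g` exist: `CLevelData.exists_geometric_not_mem_range`), given (P1) `Ker(Π_X → G_K) = Δ_X`
through the once-punctured parameters. [cite: MochizukiEtTh2009, Prop 2.2 (i) p.37] -/
theorem piCDataOf_inv_ell_of_hinv (eX : M.toThetaSetting.OncePuncturedData) (l : ℕ) {g : M.GtpC}
    (hg : e.augC g = 1) (hgX : g ∉ M.inclX.range)
    (hinv : ∀ y ∈ M.DeltaHat,
      M.completionAut (e.conjX g) y * y ∈ (⁅M.DeltaHat, M.DeltaHat⁆).topologicalClosure) :
    ∀ c ∈ (e.piCDataOf ιC hιC).augGK.ker, c ∉ (e.piCDataOf ιC hιC).PiX →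
      ∀ d ∈ (e.piCDataOf ιC hιC).PiX ⊓ (e.piCDataOf ιC hιC).augGK.ker,
        c * d * c⁻¹ * d ∈ (e.piCDataOf ιC hιC).barTheta l := by
  refine (e.piCDataOf ιC hιC).inv_ell_of_one l eX ((e.piCDataOf_ιC_mem_ker_augGK_iff ιC hιC g).2 hg)
    (fun h => hgX ((e.piCDataOf_ιC_mem_PiX_iff ιC hιC g).1 h)) fun d hd => ?_
  rw [← (e.piCDataOf ιC hιC).deltaX_eq eX] at hd
  exact e.piCDataOf_conj_mul_mem_barTheta_of_hinv ιC hιC l hinv d hd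

/-- **The same at THE profinite completion `e.piCData`** (`Π_C := PiCHat e`). [cite: MochizukiEtTh2009, Prop 2.2 (i) p.37] -/
theorem piCData_inv_ell_of_hinv (eX : M.toThetaSetting.OncePuncturedData) (l : ℕ) {g : M.GtpC}
    (hg : e.augC g = 1) (hgX : g ∉ M.inclX.range)
    (hinv : ∀ y ∈ M.DeltaHat,
      M.completionAut (e.conjX g) y * y ∈ (⁅M.DeltaHat, M.DeltaHat⁆).topologicalClosure) :
    ∀ c ∈ e.piCData.augGK.ker, c ∉ e.piCData.PiX →
      ∀ d ∈ e.piCData.PiX ⊓ e.piCData.augGK.ker, c * d * c⁻¹ * d ∈ e.piCData.barTheta l :=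
  e.piCDataOf_inv_ell_of_hinv _ _ eX l hg hgX hinv

/-- **… and then the second binder `hιtheta`** («`ι` acts on `Δ̄_Θ` by `+1`») by abc-iut-L6-d6's
`PiCData.inv_theta_of_inv_ell` (commutator pairing). [cite: MochizukiEtTh2009, Prop 2.2 (i) p.37] -/
theorem piCData_inv_theta_of_hinv (eX : M.toThetaSetting.OncePuncturedData) (l : ℕ) {g : M.GtpC}
    (hg : e.augC g = 1) (hgX : g ∉ M.inclX.range)
    (hinv : ∀ y ∈ M.DeltaHat,
      M.completionAut (e.conjX g) y * y ∈ (⁅M.DeltaHat, M.DeltaHat⁆).topologicalClosure) :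
    ∀ c ∈ e.piCData.augGK.ker, c ∉ e.piCData.PiX →
      ∀ t ∈ e.piCData.barTheta l, c * t * c⁻¹ * t⁻¹ ∈ e.piCData.barKer l :=
  e.piCData.inv_theta_of_inv_ell l eX (e.piCData_inv_ell_of_hinv eX l hg hgX hinv)

/-- Existence form: if SOME geometric `g ∉ Π^tp_X` of `Π^tp_C` satisfies (R1e′), both Prop. 2.2 (i)
eigenvalue binders of `coverDataAx` hold at `e.piCData`. [cite: MochizukiEtTh2009, Prop 2.2 (i) p.37] -/
theorem piCData_inv_ell_and_inv_theta_of_exists_hinv (eX : M.toThetaSetting.OncePuncturedData) (l : ℕ)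
    (h : ∃ g : M.GtpC, e.augC g = 1 ∧ g ∉ M.inclX.range ∧ ∀ y ∈ M.DeltaHat,
      M.completionAut (e.conjX g) y * y ∈ (⁅M.DeltaHat, M.DeltaHat⁆).topologicalClosure) :
    (∀ c ∈ e.piCData.augGK.ker, c ∉ e.piCData.PiX →
      ∀ d ∈ e.piCData.PiX ⊓ e.piCData.augGK.ker, c * d * c⁻¹ * d ∈ e.piCData.barTheta l) ∧
    (∀ c ∈ e.piCData.augGK.ker, c ∉ e.piCData.PiX →
      ∀ t ∈ e.piCData.barTheta l, c * t * c⁻¹ * t⁻¹ ∈ e.piCData.barKer l) := by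
  obtain ⟨g, hg, hgX, hinv⟩ := h
  exact ⟨e.piCData_inv_ell_of_hinv eX l hg hgX hinv, e.piCData_inv_theta_of_hinv eX l hg hgX hinv⟩

end MuTwoSetting.CLevelData

/-! ## §4. WITNESSED at the inversion model `Π^tp_C = Π^tp_X ⋊_ι ℤ/2` (every C-level datum over it) -/

namespace SettingModel

variable (p : ℕ) [Fact p.Prime]

/-- At the root `Π_X = F̂₂ × Γ̂`, `Δ_X = F̂₂ × 1`: `Π_X` acts TRIVIALLY on `Δ_X^ab` — `y·d·y⁻¹·d⁻¹ ∈ ⁅Δ_X, Δ_X⁆`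
for every `y ∈ Π_X`, `d ∈ Δ_X` (the arithmetic factor is a direct factor; a degenerate feature of the root
model). [cite: MochizukiEtTh2009, §1 p.12] -/
theorem commutatorElement_mem_commutator_deltaHat_model (y d : PiHt p) (hd : d ∈ (ThetaSetting.model p).DeltaHat) :
    y * d * y⁻¹ * d⁻¹ ∈ ⁅(ThetaSetting.model p).DeltaHat, (ThetaSetting.model p).DeltaHat⁆ := by
  have hd2 : d.2 = 1 := snd_eq_one_of_mem_deltaHat p hd
  have key : y * d * y⁻¹ * d⁻¹ = ⁅((y.1, 1) : PiHt p), d⁆ := by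
    obtain ⟨y₁, y₂⟩ := y
    obtain ⟨d₁, d₂⟩ := d
    change d₂ = 1 at hd2
    subst hd2
    rw [commutatorElement_def]
    ext <;> simp
  rw [key]
  exact Subgroup.commutator_mem_commutator (mk_one_mem_deltaHat p y.1) hd

variable (e : (MuTwoSetting.inversionModel p).CLevelData)

/-- `ε̂_± ∉ Π_X` inside `Π_C := e.PiCHat` (`ε_± ∉ inclX(Π^tp_X)`), for every C-level datum `e` over the
inversion model. [cite: MochizukiEtTh2009, Def 1.7 p.27] -/
theorem inversionModel_toPiCHat_epsPM_not_mem_PiX :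
    e.toPiCHat (MuTwoSetting.inversionModel p).epsPM ∉ e.piCData.PiX := by
  rw [MuTwoSetting.CLevelData.piCData, MuTwoSetting.CLevelData.piCDataOf_ιC_mem_PiX_iff]
  exact (MuTwoSetting.inversionModel p).epsPM_not_mem

/-- Some GEOMETRIC element of `Π_C ∖ Π_X` (`c ∈ Ker(Π_C ↠ G_K)`, `c ∉ Π_X`) exists inside `Π_C := e.PiCHat`:
the image of abc-iut-L2-d3's `exists_geometric_not_mem_range`. [cite: MochizukiEtTh2009, Prop 2.2 p.36] -/
theorem inversionModel_exists_mem_ker_not_mem_PiX :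
    ∃ c : e.PiCHat, c ∈ e.piCData.augGK.ker ∧ c ∉ e.piCData.PiX := by
  obtain ⟨g, hgX, hg⟩ := e.exists_geometric_not_mem_range
  refine ⟨e.toPiCHat g, ?_, ?_⟩
  · rw [MuTwoSetting.CLevelData.piCData, MuTwoSetting.CLevelData.piCDataOf_ιC_mem_ker_augGK_iff]
    exact hg
  · rw [MuTwoSetting.CLevelData.piCData, MuTwoSetting.CLevelData.piCDataOf_ιC_mem_PiX_iff]
    exact hgX

/-- **WITNESSED (pointwise at `ε̂_±`)**: in `Π_C := e.PiCHat`, `ε̂_± · d · ε̂_±⁻¹ · d ∈ barTheta l` for every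
`d ∈ Δ_X` — «`ι` acts on `Δ̄^ell_X` by `−1`» HOLDS for the genuine inversion: `e.conjX ε_±` is the pointed
inversion `SettingModel.inversion p` (conjugation by `ε_± = inr 1̄` on `Π^tp_X ⋊_ι ℤ/2` is `ι`), which
satisfies (R1e′) (abc-iut-w5-d072's `inversion_hinv`). [cite: MochizukiEtTh2009, Prop 2.2 (i) p.37] -/
theorem inversionModel_piCData_epsPM_conj_mul_mem_barTheta (l : ℕ) :
    ∀ d ∈ e.piCData.DeltaX,
      e.toPiCHat (MuTwoSetting.inversionModel p).epsPM * d * (e.toPiCHat (MuTwoSetting.inversionModel p).epsPM)⁻¹ * d ∈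
        e.piCData.barTheta l := by
  -- `e.conjX ε_± = ι` (as in abc-iut-w5-d072's `conjX_epsPM_inversionModel`, re-derived here over the built modules)
  have hconj : e.conjX (MuTwoSetting.inversionModel p).epsPM = inversion p := by
    refine ContinuousMulEquiv.ext fun x => (MuTwoSetting.inversionModel p).injective_inclX ?_
    rw [e.inclX_conjX]
    exact MuTwoSetting.inversionModel_epsPM_conj p x
  refine e.piCDataOf_conj_mul_mem_barTheta_of_hinv _ _ l fun y hy => ?_
  rw [hconj]
  exact inversion_hinv p y hy

/-- **WITNESSED (`Δ_X`-form of the binder `hιell`)**: in `Π_C := e.PiCHat`, EVERY `c ∉ Π_X` satisfies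
`c · d · c⁻¹ · d ∈ barTheta l` for all `d ∈ Δ_X` (`c = ε̂_± · x` with `x ∈ Π_X`, which acts trivially on
`Δ_X^ab` at the root). The consumer form of `coverDataAx` quantifies over `Π_X ∩ Δ_C (= Δ_X` under (P1));
(P1) is carried by `OncePuncturedData`, EMPTY at the root — so this is the form available there.
[cite: MochizukiEtTh2009, Prop 2.2 (i) p.37] -/
theorem inversionModel_piCData_inv_ell_deltaX (l : ℕ) :
    ∀ c : e.PiCHat, c ∉ e.piCData.PiX → ∀ d ∈ e.piCData.DeltaX, c * d * c⁻¹ * d ∈ e.piCData.barTheta l := by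
  set I := e.piCData with hI
  set c₁ := e.toPiCHat (MuTwoSetting.inversionModel p).epsPM with hc₁
  intro c hcX d hd
  have hc₁X : c₁ ∉ I.PiX := inversionModel_toPiCHat_epsPM_not_mem_PiX p e
  have hxX : c₁⁻¹ * c ∈ I.PiX :=
    (Subgroup.mul_mem_iff_of_index_two I.index_range).2
      (iff_of_false (fun h => hc₁X (by simpa using h)) hcX)
  -- `x = incl y` commutes with `d = incl d'` modulo `⁅Δ_X,Δ_X⁆ ≤ barTheta`
  have hk : c₁⁻¹ * c * d * (c₁⁻¹ * c)⁻¹ * d⁻¹ ∈ I.barTheta l := by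
    obtain ⟨y, hy⟩ := hxX
    obtain ⟨d', hd', rfl⟩ := hd
    rw [← hy]
    change I.incl y * I.incl d' * (I.incl y)⁻¹ * (I.incl d')⁻¹ ∈ I.barTheta l
    rw [← map_inv, ← map_inv, ← map_mul, ← map_mul, ← map_mul]
    refine I.commutator_deltaX_le_barTheta l ?_
    rw [ThetaSetting.PiCData.DeltaX, ← Subgroup.map_commutator]
    exact ⟨_, commutatorElement_mem_commutator_deltaHat_model p y d' hd', rfl⟩
  have h₁ : c₁ * d * c₁⁻¹ * d ∈ I.barTheta l :=
    inversionModel_piCData_epsPM_conj_mul_mem_barTheta p e l d hd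
  have h := ThetaSetting.PiCData.conj_mul_mem_of_commutator_mem (I.barTheta l)
    (e.piCDataOf_barTheta_normal _ _ l) hk h₁
  rwa [mul_inv_cancel_left] at h

/-- **At the inversion model the §2 input carries the eigenvalue `−1` for every C-level datum**: some
`c ∈ Ker(Π_C ↠ G_K) ∖ Π_X` exists and every `c ∉ Π_X` satisfies `c · d · c⁻¹ · d ∈ barTheta l` on `Δ_X`.
(At abc-iut-L2-t1's product model `Π_X × ℤ/2` the clause fails for every C-level datum: (R1e′) fails there,
`SettingModelMuTwoInversionCLevel.not_hinv_conjX_epsPM_model`.) [cite: MochizukiEtTh2009, Prop 2.2 (i) p.37] -/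
theorem inversionModel_piCData_inv_ell_witness (l : ℕ) :
    (∃ c : e.PiCHat, c ∈ e.piCData.augGK.ker ∧ c ∉ e.piCData.PiX) ∧
      ∀ c : e.PiCHat, c ∉ e.piCData.PiX → ∀ d ∈ e.piCData.DeltaX, c * d * c⁻¹ * d ∈ e.piCData.barTheta l :=
  ⟨inversionModel_exists_mem_ker_not_mem_PiX p e, inversionModel_piCData_inv_ell_deltaX p e l⟩

end SettingModel

end Literature.AnabelianGeometry.EtaleTheta

end
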